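import Mathlib.AlgebraicGeometry.EllipticCurve.Affine.Point
import Mathlib.Algebra.Polynomial.Derivative
import Summits.Ventures.AbcSig.Levels.N10016QCurve

/-!
# Venture AbcSig — the printed 2-isogeny of `E` to its conjugate and the kernel form of «`m = +2`» (CHECK X)

HONEST FRAMING. Support file of the computation cell `pub-abcsig` (HOME = run/shared/lean/pub/pub-abcsig/), companion of
`Levels/N10016QCurve.lean` (p510507: the DERIVED elliptic curve `E : y² = x³ + (−132 + 132i)x² + (3419 − 4356i)x` over `ℤ[i]` that three
hands of the cell IDENTIFIED behind the newform orbit 10016.1 — identification (H_id), re-graded DERIVED modulo printed theorems by the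
lead, HOME/STRUCTURE.md §8b (au); NOT proved here and NOT used as a hypothesis of any theorem below). What the kernel checks in this file
are ALGEBRAIC IDENTITIES of the PRINTED degree-2 maps attached to a model `y² = x³ + a·x² + b·x` [ST92, III §4], [Sil09, III.4.5]:

* GENERIC (any field `F`; `2 ≠ 0` where a tangent slope is needed). `φ(x, y) = (y²/x², y(x² − b)/x²)` maps the affine points `x ≠ 0` of
  `W_{a,b} = [0, a, 0, b, 0]` to the printed codomain `W̄ = twoIsogenyCodomain a b = [0, −2a, 0, a² − 4b, 0]` (`twoIsogeny_equation`);
  `ψ` = the same formula on `W̄` lands on `[0, 4a, 0, 16b, 0]`; and **`ψ ∘ φ` followed by the scaling `(X, Y) ↦ (X/4, Y/8)` IS MATHLIB'S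
  DOUBLING**: its coordinates are `W.addX x x L`, `W.addY x x y L` with `L = W.slope x x y y` the tangent slope (`dblX_eq_addX`,
  `dblY_eq_addY`), hence `ψ̂ (φ P) = P + P` in Mathlib's group of points (`add_self_eq_dbl`) — the printed «`φ̄ ∘ φ = [2]`» [ST92, III §4,
  Prop. p. 83] with the SIGN living in the `y`-coordinate and checked against Mathlib's group law (not against a differential).
* The FORMAL PULLBACK identity `X·f′ − 2·f = X·(X² − b)` for `f = X³ + aX² + bX`, `f′` = Mathlib's `Polynomial.derivative`
  (`pullback_numerator`): it is what makes `φ*(dX/2Y) = dx/2y` (`c_φ = +1` for the sign `Y = y(x² − b)/x²`; the other printed sign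
  `y(b − x²)/x²`, in the docstring of `twoIsogenyCodomain` and on one hand of the cell, is `[−1] ∘ φ`, `c = −1`; `ι_u` has `c = u`) — this
  READING by the chain rule is docstring-level; only the polynomial identity is in the kernel.
* SPECIFIC (namespace `L313QCurve`, over any field `K` receiving `ℤ[i] →+* K` in which `2 ≠ 0`): `ν := ι_{1+i} ∘ φ : E → E^σ` lands on
  `Econj` (`nu_equation`, via p510507's coefficient identity `isogenyCodomain_eq_intScale_conj`), `μ := ν^σ` — the same formulas with
  the conjugated constants `1 − i`, `σ(a₄)` — maps `E^σ → E` (`mu_equation`), and **`μ ∘ ν` has the coordinates of `ψ̂ ∘ φ`**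
  (`mu_nu_X`, `mu_nu_Y`: only `(1+i)(1−i) = 2` and `(1+i)⁴·σ(a₄) = a₂² − 4a₄` enter, so this does not depend on the sign `u = ±(1+i)`),
  **hence `μ (ν P) = P + P` on `E(K)`** (`add_self_eq_mu_nu`): the kernel form of the cell's CHECK X constant «`m = a_ν·a_μ = N(1+i) = +2`»
  (HOME/STRUCTURE.md §8b (au): referee ref-g89 (e2) «a theorem»; computed by lit g29 §3(a), engine-2 g32, bench g32).

WHAT THIS IS NOT. That `φ` is an ISOGENY with kernel `{O, (0, 0)}`, that `ψ̂` is its dual, and Vélu's formulas are CITED ([ST92, III §4],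
[Sil09, III.4.5, III.6.1–6.2]) — the kernel checks the identities of the printed rational maps on the affine points with `x ≠ 0`, `y ≠ 0`
(`O`, the kernel point `(0, 0)` and the other affine 2-torsion points `y = 0` are EXCLUDED by hypothesis and nothing is claimed there; no
morphism of curves/schemes is constructed). The differential pullback beyond the polynomial identity `pullback_numerator`, «isogeny» as
a morphism of schemes, `End⁰(Res_{ℚ(i)/ℚ} E) = ℚ(√2)`, modularity and the identification (H_id) «10016.1 ↔ E» are NOT formalised and NOT
claimed. Nothing at the prime `(1+i)`, no conductor, no `L`-function; (H_id) and the framework hypothesis (H) of the cell are untouched;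
nothing here is a claim on `Q(313; 23)`, on any equation's solutions, on ABC or any summit. A sign/group-law theorem for an explicit pair
of printed 2-isogeny formulas on the identified curve, nothing more. Lead word: HOME/INBOX 2026-08-27T07:56:30Z «YES/KEY pub-abcsig-p-lean
← QCURVE-ISOGENY-SIGN-LEAN» (lead g19, conditions (a)–(e); p-lean g18).

References: [ST92] J. H. Silverman, J. Tate, *Rational Points on Elliptic Curves*, UTM, Springer 1992, III §4 (`φ`, `ψ`, `ψ ∘ φ = [2]`,
pp. 79–83); [Sil09] J. H. Silverman, *The Arithmetic of Elliptic Curves*, GTM 106, 2nd ed. 2009, III.4.5, III.5, III.6.1–6.2. Cell records: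
HOME/STRUCTURE.md §8b (au)-ADDENDUM 2–3, lit g29 §3, engine-2 results/CHECK-Y-ORBITS-g32/, bench/rows/XREAD-L313-FROBQI-1M-g32/checkx/.
-/

namespace Summit.Ventures.AbcSig.L313QCurve

open Summit.Ventures.AbcSig Polynomial

/-! ## Generic: the model `[0, a, 0, b, 0]`, the printed 2-isogeny `φ` and its dual composite ([ST92, III §4]) -/

section Generic

variable {R S : Type*} [CommRing R] [CommRing S] {F : Type*} [Field F]

/-- The Weierstrass model `[0, a, 0, b, 0]`: `y² = x³ + a·x² + b·x`, with the rational 2-torsion point `(0, 0)`. -/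
def curveAB (a b : R) : WeierstrassCurve R := ⟨0, a, 0, b, 0⟩

/-- The affine equation of `[0, a, 0, b, 0]` is `y² = x³ + a x² + b x`. -/
theorem curveAB_equation_iff (a b x y : R) :
    (curveAB a b).toAffine.Equation x y ↔ y ^ 2 = x ^ 3 + a * x ^ 2 + b * x := by
  rw [WeierstrassCurve.Affine.equation_iff]
  change y ^ 2 + 0 * x * y + 0 * y = x ^ 3 + a * x ^ 2 + b * x + 0 ↔ _
  constructor <;> intro h <;> linear_combination h

/-- `[0, a, 0, b, 0]` commutes with base change. -/
theorem curveAB_map (f : R →+* S) (a b : R) : (curveAB a b).map f = curveAB (f a) (f b) := by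
  ext <;> simp [curveAB, WeierstrassCurve.map]

/-- The printed codomain `twoIsogenyCodomain a b` (p510507) is the model `[0, −2a, 0, a² − 4b, 0]` (by definition). -/
theorem twoIsogenyCodomain_eq_curveAB (a b : R) : twoIsogenyCodomain a b = curveAB (-2 * a) (a ^ 2 - 4 * b) := rfl

/-- Integral rescaling of `[0, a, 0, b, 0]` by `u` is `[0, u²a, 0, u⁴b, 0]`. -/
theorem intScale_curveAB (u a b : R) : intScale u (curveAB a b) = curveAB (u ^ 2 * a) (u ^ 4 * b) := by
  ext <;> simp [intScale, curveAB]

/-- Applying the codomain construction twice gives the `2`-rescaled original model: `[0, 4a, 0, 16b, 0] = intScale 2 [0, a, 0, b, 0]`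
([ST92, III §4]: "`C̿` is isomorphic to `C` via `(x, y) ↦ (x/4, y/8)`"). -/
theorem twoIsogenyCodomain_twice (a b : R) :
    twoIsogenyCodomain (-2 * a) (a ^ 2 - 4 * b) = intScale 2 (curveAB a b) := by
  ext <;> simp [twoIsogenyCodomain, intScale, curveAB] <;> ring

/-- `x`-coordinate of the PRINTED 2-isogeny `φ` with kernel `⟨(0, 0)⟩` on `y² = x³ + a x² + b x`: `X = y²/x²` [ST92, III §4]. -/
def twoIsogenyX (x y : F) : F := y ^ 2 / x ^ 2

/-- `y`-coordinate of the PRINTED 2-isogeny `φ`: `Y = y·(x² − b)/x²` [ST92, III §4] (sign convention of the book; the other sign is `[−1] ∘ φ`). -/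
def twoIsogenyY (b x y : F) : F := y * (x ^ 2 - b) / x ^ 2

/-- **`φ` lands on the printed codomain.** If `(x, y)` satisfies `y² = x³ + a x² + b x` and `x ≠ 0`, then `φ(x, y) = (y²/x², y(x² − b)/x²)`
satisfies the equation of `twoIsogenyCodomain a b`: `Y² = X³ − 2a X² + (a² − 4b) X` ([ST92, III §4, p. 79]). Pure identity of rational
functions after the substitution `y² = x³ + a x² + b x`. -/
theorem twoIsogeny_equation {a b x y : F} (h : (curveAB a b).toAffine.Equation x y) (hx : x ≠ 0) :
    (twoIsogenyCodomain a b).toAffine.Equation (twoIsogenyX x y) (twoIsogenyY b x y) := by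
  rw [curveAB_equation_iff] at h
  rw [twoIsogenyCodomain_eq_curveAB, curveAB_equation_iff, twoIsogenyX, twoIsogenyY]
  simp only [div_pow, mul_pow]
  rw [h]
  field_simp
  ring

/-- `φ` of a point with `x ≠ 0`, `y ≠ 0` has nonzero `X`-coordinate (so `ψ` may be applied to it). -/
theorem twoIsogenyX_ne_zero {x y : F} (hx : x ≠ 0) (hy : y ≠ 0) : twoIsogenyX x y ≠ 0 :=
  div_ne_zero (pow_ne_zero 2 hy) (pow_ne_zero 2 hx)

/-- `x`-coordinate of `ψ̂ ∘ φ`: apply the printed formula again on the codomain (`ψ`) and rescale by `(X, Y) ↦ (X/4, Y/8)` [ST92, III §4]. -/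
def dblX (b x y : F) : F := twoIsogenyX (twoIsogenyX x y) (twoIsogenyY b x y) / 4

/-- `y`-coordinate of `ψ̂ ∘ φ` (the codomain's `b̄` is `a² − 4b`), rescaled by `1/8` [ST92, III §4]. -/
def dblY (a b x y : F) : F := twoIsogenyY (a ^ 2 - 4 * b) (twoIsogenyX x y) (twoIsogenyY b x y) / 8

/-- Rescaling: a solution of `[0, u²A, 0, u⁴B, 0]` gives the solution `(X/u², Y/u³)` of `[0, A, 0, B, 0]` when `u ≠ 0` (the substitution
behind `intScale`; [Sil09, III §1]). -/
theorem curveAB_equation_unscale {u A B X Y : F} (h : (curveAB (u ^ 2 * A) (u ^ 4 * B)).toAffine.Equation X Y) (hu : u ≠ 0) :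
    (curveAB A B).toAffine.Equation (X / u ^ 2) (Y / u ^ 3) := by
  rw [curveAB_equation_iff] at h ⊢
  rw [div_pow, h]
  field_simp

/-- **`ψ̂ ∘ φ` lands back on the original model** ([ST92, III §4]: `ψ` maps `C̄` to `C̿ = [0, 4a, 0, 16b, 0] = intScale 2 C`, and
`(X, Y) ↦ (X/4, Y/8)` maps `C̿` to `C`): for `(x, y)` on `[0, a, 0, b, 0]` with `x ≠ 0`, `y ≠ 0` and `2 ≠ 0` in `F`, the point
`(dblX, dblY)` satisfies the equation of `[0, a, 0, b, 0]`. (Points with `x = 0` or `y = 0` — the affine 2-torsion — and `O` are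
excluded by hypothesis; nothing is claimed about them.) -/
theorem dbl_equation {a b x y : F} (h : (curveAB a b).toAffine.Equation x y) (hx : x ≠ 0) (hy : y ≠ 0) (h2 : (2 : F) ≠ 0) :
    (curveAB a b).toAffine.Equation (dblX b x y) (dblY a b x y) := by
  have h1 := twoIsogeny_equation h hx
  rw [twoIsogenyCodomain_eq_curveAB] at h1
  have h2' := twoIsogeny_equation h1 (twoIsogenyX_ne_zero hx hy)
  rw [twoIsogenyCodomain_twice, intScale_curveAB] at h2'
  have h3 := curveAB_equation_unscale h2' h2
  norm_num at h3
  exact h3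

/-- Mathlib's `addX` for `[0, a, 0, b, 0]`: `x₃ = L² − a − x₁ − x₂`. -/
theorem curveAB_addX (a b x₁ x₂ L : F) : (curveAB a b).toAffine.addX x₁ x₂ L = L ^ 2 - a - x₁ - x₂ := by
  change L ^ 2 + 0 * L - a - x₁ - x₂ = _
  ring

/-- Mathlib's `addY` for `[0, a, 0, b, 0]`: `y₃ = −(L·(x₃ − x₁) + y₁)`. -/
theorem curveAB_addY (a b x₁ x₂ y₁ L : F) :
    (curveAB a b).toAffine.addY x₁ x₂ y₁ L = -(L * ((curveAB a b).toAffine.addX x₁ x₂ L - x₁) + y₁) := by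
  change -(L * ((curveAB a b).toAffine.addX x₁ x₂ L - x₁) + y₁) - 0 * _ - 0 = _
  ring

/-- In a field with `2 ≠ 0`: `4 ≠ 0` and `8 ≠ 0` (denominators of `ψ̂`). -/
theorem four_eight_ne_zero {L : Type*} [Field L] (h2 : (2 : L) ≠ 0) : (4 : L) ≠ 0 ∧ (8 : L) ≠ 0 := by
  have e4 : (4 : L) = 2 * 2 := by norm_num
  have e8 : (8 : L) = 2 * (2 * 2) := by norm_num
  rw [e4, e8]
  exact ⟨mul_ne_zero h2 h2, mul_ne_zero h2 (mul_ne_zero h2 h2)⟩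

variable [DecidableEq F]

/-- The tangent slope of Mathlib at a point `(x, y)`, `y ≠ 0`, of `[0, a, 0, b, 0]` (with `2 ≠ 0`): `L = (3x² + 2ax + b)/(2y)`. -/
theorem curveAB_slope_self {a b x y : F} (hy : y ≠ 0) (h2 : (2 : F) ≠ 0) :
    (curveAB a b).toAffine.slope x x y y = (3 * x ^ 2 + 2 * a * x + b) / (2 * y) := by
  have hne : y ≠ (curveAB a b).toAffine.negY x y := fun h =>
    (mul_ne_zero h2 hy) (by change y = -y - 0 * x - 0 at h; linear_combination h)
  rw [WeierstrassCurve.Affine.slope_of_Y_ne rfl hne]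
  change (3 * x ^ 2 + 2 * a * x + b - 0 * y) / (y - (-y - 0 * x - 0)) = _
  congr 1 <;> ring

/-- **`x(ψ̂ φ P) = x(P + P)`** ([ST92, III §4, Prop. p. 83], `x`-coordinate): for `(x, y)` on `[0, a, 0, b, 0]` with `x ≠ 0`, `y ≠ 0`
(and `2 ≠ 0` in `F`), `dblX b x y = (x² − b)²/(4y²)` equals Mathlib's `addX x x L` with the tangent slope `L`. -/
theorem dblX_eq_addX {a b x y : F} (h : (curveAB a b).toAffine.Equation x y) (hx : x ≠ 0) (hy : y ≠ 0) (h2 : (2 : F) ≠ 0) :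
    dblX b x y = (curveAB a b).toAffine.addX x x ((curveAB a b).toAffine.slope x x y y) := by
  rw [curveAB_slope_self hy h2, curveAB_addX]
  rw [curveAB_equation_iff] at h
  have hf : x ^ 3 + a * x ^ 2 + b * x ≠ 0 := by
    rw [← h]
    exact pow_ne_zero 2 hy
  have hg : x ^ 2 + a * x + b ≠ 0 := fun h0 => hf (by linear_combination x * h0)
  obtain ⟨h4, -⟩ := four_eight_ne_zero h2
  -- substitute `y² = x·(x² + a x + b)`: what is left is an identity of rational functions of `x`
  have h' : y ^ 2 = x * (x ^ 2 + a * x + b) := by rw [h]; ring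
  simp only [dblX, twoIsogenyX, twoIsogenyY, div_pow, mul_pow]
  rw [h']
  -- treat `g = x² + a x + b ≠ 0` as an atom while clearing denominators, then substitute it back
  generalize hg_def : x ^ 2 + a * x + b = g at hg ⊢
  field_simp
  rw [← hg_def]
  ring

/-- **`y(ψ̂ φ P) = y(P + P)`** ([ST92, III §4, Prop. p. 83], `y`-coordinate — the SIGN): for `(x, y)` on `[0, a, 0, b, 0]` with `x ≠ 0`,
`y ≠ 0` (and `2 ≠ 0`), `dblY a b x y` equals Mathlib's `addY x x y L` with the tangent slope `L` (NOT its negative `negAddY`). -/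
theorem dblY_eq_addY {a b x y : F} (h : (curveAB a b).toAffine.Equation x y) (hx : x ≠ 0) (hy : y ≠ 0) (h2 : (2 : F) ≠ 0) :
    dblY a b x y = (curveAB a b).toAffine.addY x x y ((curveAB a b).toAffine.slope x x y y) := by
  rw [curveAB_addY, curveAB_addX, curveAB_slope_self hy h2]
  rw [curveAB_equation_iff] at h
  have hf : x ^ 3 + a * x ^ 2 + b * x ≠ 0 := by
    rw [← h]
    exact pow_ne_zero 2 hy
  have hg : x ^ 2 + a * x + b ≠ 0 := fun h0 => hf (by linear_combination x * h0)
  obtain ⟨h4, h8⟩ := four_eight_ne_zero h2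
  -- substitute `y² = x·g(x)`, `g = x² + a x + b`: both sides become `y` times a rational function of `x`
  have h' : y ^ 2 = x * (x ^ 2 + a * x + b) := by rw [h]; ring
  have key : dblY a b x y =
      y * ((x ^ 2 - b) * ((x ^ 2 + a * x + b) ^ 2 - (a ^ 2 - 4 * b) * x ^ 2) / (8 * x ^ 2 * (x ^ 2 + a * x + b) ^ 2)) := by
    simp only [dblY, twoIsogenyX, twoIsogenyY, div_pow]
    rw [h']
    field_simp
  have e1 : (3 * x ^ 2 + 2 * a * x + b) / (2 * y) =
      y * ((3 * x ^ 2 + 2 * a * x + b) / (2 * (x * (x ^ 2 + a * x + b)))) := by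
    rw [← h']
    field_simp
  have key' : -((3 * x ^ 2 + 2 * a * x + b) / (2 * y) *
      (((3 * x ^ 2 + 2 * a * x + b) / (2 * y)) ^ 2 - a - x - x - x) + y) =
      y * -((3 * x ^ 2 + 2 * a * x + b) *
          ((3 * x ^ 2 + 2 * a * x + b) ^ 2 - 4 * (a + 3 * x) * (x * (x ^ 2 + a * x + b))) /
            (8 * x ^ 2 * (x ^ 2 + a * x + b) ^ 2) + 1) := by
    rw [e1]
    simp only [mul_pow]
    rw [h']
    generalize hg_def : x ^ 2 + a * x + b = g at hg ⊢
    field_simp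
    ring
  rw [key, key']
  congr 1
  generalize hg_def : x ^ 2 + a * x + b = g at hg ⊢
  field_simp
  rw [← hg_def]
  ring

/-- **`ψ̂ (φ P) = P + P` in Mathlib's group of points** ([ST92, III §4]: `φ̄ ∘ φ` = multiplication by `2`), for the affine points
`P = (x, y)` with `x ≠ 0`, `y ≠ 0`, `2 ≠ 0` in `F` — i.e. away from `O` and the affine 2-torsion `y = 0` (where the printed formulas
have poles or the tangent is vertical; those points are EXCLUDED by hypothesis, nothing is claimed about them). The point `(dblX, dblY)`
is nonsingular because it IS `P + P`. In particular the composite is `+(P + P)`, not `−(P + P)`: the `y`-coordinate is `addY`. -/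
theorem add_self_eq_dbl {a b x y : F} (hP : (curveAB a b).toAffine.Nonsingular x y) (hx : x ≠ 0) (hy : y ≠ 0) (h2 : (2 : F) ≠ 0) :
    ∃ hQ : (curveAB a b).toAffine.Nonsingular (dblX b x y) (dblY a b x y),
      WeierstrassCurve.Affine.Point.some x y hP + WeierstrassCurve.Affine.Point.some x y hP =
        WeierstrassCurve.Affine.Point.some (dblX b x y) (dblY a b x y) hQ := by
  have hne : y ≠ (curveAB a b).toAffine.negY x y := fun h =>
    (mul_ne_zero h2 hy) (by change y = -y - 0 * x - 0 at h; linear_combination h)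
  have hX := dblX_eq_addX hP.1 hx hy h2
  have hY := dblY_eq_addY hP.1 hx hy h2
  refine ⟨?_, ?_⟩
  · rw [hX, hY]
    exact WeierstrassCurve.Affine.nonsingular_add hP hP fun hxy => hne hxy.2
  · rw [WeierstrassCurve.Affine.Point.add_self_of_Y_ne hne]
    simp only [WeierstrassCurve.Affine.Point.some.injEq]
    exact ⟨hX.symm, hY.symm⟩

/-! ### The formal pullback identity behind `φ*(dX/2Y) = dx/2y` -/

/-- **Formal pullback identity** (kernel-certified differentiation): for `f = X³ + a·X² + b·X` and `f′ = Polynomial.derivative f`,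
`X·f′ − 2·f = X·(X² − b)`. READING (docstring-level, [Sil09, III.5]): on the curve `y² = f(x)` one has `2y·dy = f′(x)·dx`, so for
`X_φ = y²/x² = f(x)/x²`, `dX_φ = (x·f′ − 2f)/x³·dx = ((x² − b)/x²)·dx`, while `2Y_φ = 2y·(x² − b)/x²`; hence `φ*(dX/2Y) = dx/2y`, i.e.
the pullback constant of `φ` on the invariant differential is `c_φ = +1` for the sign `Y = y(x² − b)/x²` (and `−1` for the other printed
sign). For the scaling `ι_u (X, Y) = (X/u², Y/u³)`: `ι_u*(dx/2y) = u·dX/2Y`. So `ν = ι_u ∘ φ` has constant `u` and its conjugate `μ`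
has `σ(u)`: `a_ν·a_μ = u·σ(u) = N(u) = 2` for `u = ±(1 ± i)` — the cell's «`m = +2`», consistent with `μ ∘ ν = [2]` proved below at the
level of points. -/
theorem pullback_numerator (a b : R) :
    X * derivative (X ^ 3 + C a * X ^ 2 + C b * X) - 2 * (X ^ 3 + C a * X ^ 2 + C b * X) = X * (X ^ 2 - C b) := by
  simp only [derivative_add, derivative_mul, derivative_X_pow, derivative_C, derivative_X, map_natCast]
  push_cast
  ring

/-- The derivative of `f = X³ + aX² + bX` evaluates to `3x² + 2ax + b` (the numerator of Mathlib's tangent slope for `[0, a, 0, b, 0]`). -/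
theorem derivative_eval (a b x : R) :
    (derivative (X ^ 3 + C a * X ^ 2 + C b * X)).eval x = 3 * x ^ 2 + 2 * a * x + b := by
  simp only [derivative_add, derivative_mul, derivative_X_pow, derivative_C, derivative_X, map_natCast]
  simp only [eval_add, eval_mul, eval_pow, eval_X, eval_C, eval_natCast, eval_one, eval_zero]
  push_cast
  ring

end Generic

/-! ## Specific: `ν = ι_{1+i} ∘ φ : E → E^σ`, its conjugate `μ : E^σ → E`, and `μ ∘ ν = [2]` on `E(K)` -/

/-- `E = [0, a₂, 0, a₄, 0]` is the model `curveAB a2 a4` (by definition). -/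
theorem E_eq_curveAB : E = curveAB a2 a4 := rfl

/-- `E^σ = [0, σ(a₂), 0, σ(a₄), 0]` is the model `curveAB (star a2) (star a4)` (by definition). -/
theorem Econj_eq_curveAB : Econj = curveAB (star a2) (star a4) := rfl

/-- `(1 + i)(1 − i) = 2` in `ℤ[i]`. -/
theorem one_add_gi_mul_one_sub_gi : (1 + gi) * (1 - gi) = 2 := by decide +kernel

/-- `σ(1 + i) = 1 − i`. -/
theorem star_one_add_gi : star (1 + gi) = 1 - gi := by decide +kernel

/-- The conjugate of p510507's ℚ-curve identity: the printed 2-isogeny codomain of `E^σ` is the `(1 − i)`-rescaling of `E`. -/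
theorem conjCodomain_eq_intScale : twoIsogenyCodomain (star a2) (star a4) = intScale (1 - gi) E := by
  refine WeierstrassCurve.ext ?_ ?_ ?_ ?_ ?_ <;> decide +kernel

/-- The conjugate of `a2_sq_sub`: `σ(a₂)² − 4σ(a₄) = (1 − i)⁴·a₄`. -/
theorem star_a2_sq_sub : star a2 ^ 2 - 4 * star a4 = (1 - gi) ^ 4 * a4 := by decide +kernel

section OverField

variable {K : Type*} [Field K] (f : GaussianInt →+* K)

/-- `x`-coordinate of `ι_u ∘ φ`: `y²/x²` rescaled by `u⁻²` (for `ν`: `u = 1 + i`; for `μ = ν^σ`: `u = 1 − i`). -/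
def isoX (u x y : K) : K := twoIsogenyX x y / u ^ 2

/-- `y`-coordinate of `ι_u ∘ φ` on `[0, ·, 0, B, 0]`: `y(x² − B)/x²` rescaled by `u⁻³` (for `ν`: `u = 1 + i`, `B = a₄`; for `μ = ν^σ`:
`u = 1 − i`, `B = σ(a₄)` — the same formula with conjugated constants). -/
def isoY (u B x y : K) : K := twoIsogenyY B x y / u ^ 3

/-- `E` base-changed along `f : ℤ[i] → K` is `[0, f a₂, 0, f a₄, 0]`. -/
theorem E_map : E.map f = curveAB (f a2) (f a4) := by
  rw [E_eq_curveAB, curveAB_map]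

/-- `E^σ` base-changed along `f` is `[0, f σ(a₂), 0, f σ(a₄), 0]`. -/
theorem Econj_map : Econj.map f = curveAB (f (star a2)) (f (star a4)) := by
  rw [Econj_eq_curveAB, curveAB_map]

/-- In `K`: `f(1 + i)·f(1 − i) = 2`. -/
theorem map_one_add_gi_mul : f (1 + gi) * f (1 - gi) = 2 := by
  rw [← map_mul, one_add_gi_mul_one_sub_gi, map_ofNat]

/-- In `K`: `(f a₂)² − 4·f a₄ = f(1 + i)⁴ · f σ(a₄)` (p510507's `a2_sq_sub` transported). -/
theorem map_a2_sq_sub : f a2 ^ 2 - 4 * f a4 = f (1 + gi) ^ 4 * f (star a4) := by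
  have h := congrArg f a2_sq_sub
  simpa [map_sub, map_mul, map_pow, map_ofNat] using h

/-- In `K`: `(f σ(a₂))² − 4·f σ(a₄) = f(1 − i)⁴ · f a₄`. -/
theorem map_star_a2_sq_sub : f (star a2) ^ 2 - 4 * f (star a4) = f (1 - gi) ^ 4 * f a4 := by
  have h := congrArg f star_a2_sq_sub
  simpa [map_sub, map_mul, map_pow, map_ofNat] using h

/-- **`ν = ι_{1+i} ∘ φ` maps `E` to `E^σ`**: for `(x, y)` on `E/K` with `x ≠ 0` (and `f(1+i) ≠ 0`, automatic when `2 ≠ 0` in `K`),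
`(isoX (f(1+i)) x y, isoY (f(1+i)) (f a₄) x y)` satisfies the equation of `E^σ/K`. Composition of `twoIsogeny_equation` (lands on the
printed codomain), p510507's `isogenyCodomain_eq_intScale_conj` (that codomain is `intScale (1+i) E^σ`) and `curveAB_equation_unscale`. -/
theorem nu_equation {x y : K} (h : (E.map f).toAffine.Equation x y) (hx : x ≠ 0) (hu : f (1 + gi) ≠ 0) :
    (Econj.map f).toAffine.Equation (isoX (f (1 + gi)) x y) (isoY (f (1 + gi)) (f a4) x y) := by
  rw [E_map] at h
  have h1 := twoIsogeny_equation h hx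
  rw [← twoIsogenyCodomain_map, isogenyCodomain_eq_intScale_conj, intScale_map, Econj_map, intScale_curveAB] at h1
  rw [Econj_map]
  exact curveAB_equation_unscale h1 hu

/-- **`μ = ν^σ` maps `E^σ` to `E`**: for `(X, Y)` on `E^σ/K` with `X ≠ 0` (and `f(1−i) ≠ 0`), `(isoX (f(1−i)) X Y, isoY (f(1−i)) (f σ(a₄)) X Y)`
— `ν`'s formulas with conjugated constants — satisfies the equation of `E/K` (via `conjCodomain_eq_intScale`). -/
theorem mu_equation {X Y : K} (h : (Econj.map f).toAffine.Equation X Y) (hX : X ≠ 0) (hu : f (1 - gi) ≠ 0) :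
    (E.map f).toAffine.Equation (isoX (f (1 - gi)) X Y) (isoY (f (1 - gi)) (f (star a4)) X Y) := by
  rw [Econj_map] at h
  have h1 := twoIsogeny_equation h hX
  rw [← twoIsogenyCodomain_map, conjCodomain_eq_intScale, intScale_map, E_map, intScale_curveAB] at h1
  rw [E_map]
  exact curveAB_equation_unscale h1 hu

/-- If `2 ≠ 0` in `K` then `f(1 + i) ≠ 0` and `f(1 − i) ≠ 0` (their product is `2`). -/
theorem map_units_ne_zero (h2 : (2 : K) ≠ 0) : f (1 + gi) ≠ 0 ∧ f (1 - gi) ≠ 0 := by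
  have h := map_one_add_gi_mul f
  constructor <;> intro h0 <;> simp only [h0, zero_mul, mul_zero] at h <;> exact h2 h.symm

/-- **`x(μ ν P) = x(ψ̂ φ P)`**: the `x`-coordinate of `μ ∘ ν` is the generic `dblX` — only `f(1+i)·f(1−i) = 2` enters (no curve equation
needed; independent of the sign of `1 + i`). -/
theorem mu_nu_X {x y : K} (hx : x ≠ 0) (hy : y ≠ 0) (h2 : (2 : K) ≠ 0) :
    isoX (f (1 - gi)) (isoX (f (1 + gi)) x y) (isoY (f (1 + gi)) (f a4) x y) = dblX (f a4) x y := by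
  obtain ⟨hu, hub⟩ := map_units_ne_zero f h2
  have hub' : f (1 - gi) = 2 / f (1 + gi) := by
    rw [eq_div_iff hu, mul_comm]
    exact map_one_add_gi_mul f
  obtain ⟨h4, -⟩ := four_eight_ne_zero h2
  simp only [isoX, isoY, dblX, twoIsogenyX, twoIsogenyY, hub']
  field_simp
  ring

/-- **`y(μ ν P) = y(ψ̂ φ P)`**: the `y`-coordinate of `μ ∘ ν` is the generic `dblY` — only `f(1+i)·f(1−i) = 2` and
`f(1+i)⁴·f σ(a₄) = (f a₂)² − 4 f a₄` enter (no curve equation needed; independent of the sign of `1 + i`). -/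
theorem mu_nu_Y {x y : K} (hx : x ≠ 0) (hy : y ≠ 0) (h2 : (2 : K) ≠ 0) :
    isoY (f (1 - gi)) (f (star a4)) (isoX (f (1 + gi)) x y) (isoY (f (1 + gi)) (f a4) x y) = dblY (f a2) (f a4) x y := by
  obtain ⟨hu, hub⟩ := map_units_ne_zero f h2
  have hub' : f (1 - gi) = 2 / f (1 + gi) := by
    rw [eq_div_iff hu, mul_comm]
    exact map_one_add_gi_mul f
  have hB : f (star a4) = (f a2 ^ 2 - 4 * f a4) / f (1 + gi) ^ 4 := by
    rw [eq_div_iff (pow_ne_zero 4 hu), mul_comm]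
    exact (map_a2_sq_sub f).symm
  obtain ⟨h4, h8⟩ := four_eight_ne_zero h2
  simp only [isoX, isoY, dblY, twoIsogenyX, twoIsogenyY, hub', hB]
  field_simp
  ring

variable [DecidableEq K]

/-- **`μ (ν P) = P + P` on `E(K)`** — the kernel form of the cell's CHECK X «`m = +2`»: for every field `K` receiving `ℤ[i]` with `2 ≠ 0`
and every point `P = (x, y)` of `E/K` with `x ≠ 0`, `y ≠ 0`, the composite of the printed map `ν = ι_{1+i} ∘ φ : E → E^σ` with its
conjugate `μ : E^σ → E` is Mathlib's `P + P` (in particular NOT `−(P + P)`: the `y`-coordinate is `addY`, not `negAddY`). Assembled from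
`mu_nu_X`/`mu_nu_Y` and the generic `add_self_eq_dbl` ([ST92, III §4] `φ̄ ∘ φ = [2]`). The isogeny/duality statements themselves are
CITED, see the module docstring. -/
theorem add_self_eq_mu_nu {x y : K} (hP : (E.map f).toAffine.Nonsingular x y) (hx : x ≠ 0) (hy : y ≠ 0) (h2 : (2 : K) ≠ 0) :
    ∃ hQ : (E.map f).toAffine.Nonsingular
        (isoX (f (1 - gi)) (isoX (f (1 + gi)) x y) (isoY (f (1 + gi)) (f a4) x y))
        (isoY (f (1 - gi)) (f (star a4)) (isoX (f (1 + gi)) x y) (isoY (f (1 + gi)) (f a4) x y)),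
      WeierstrassCurve.Affine.Point.some x y hP + WeierstrassCurve.Affine.Point.some x y hP =
        WeierstrassCurve.Affine.Point.some _ _ hQ := by
  rw [mu_nu_X f hx hy h2, mu_nu_Y f hx hy h2]
  generalize hW : E.map f = W at hP ⊢
  obtain rfl : W = curveAB (f a2) (f a4) := by rw [← hW, E_map]
  exact add_self_eq_dbl hP hx hy h2

end OverField

end Summit.Ventures.AbcSig.L313QCurve
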